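import Summits.Parity.GeneralizedHardyLittlewood.Theorems.PrimeLevelFamEdgeMomentsBeyondDiagonalLayersFormReductionZero
import HarnessLib

/-!
# Route `PrimeLevelFamEdge`, crux K_A `MomentsBeyondDiagonal` (stmt-Parity-20007), line «petersson_layers» v4:
# range bookkeeping for the class bounds (assembly step E5b, inputs): `Y ≤ q²`, the hyperbola fits in the AFE boxes, and the
# dilated AFE length never exceeds the class modulus

Discharges of three side conditions of `…LayersClassBound(All).norm_classForm_le_of_pascadi(_all)(')` /
`…LayersClassBoundFourier.norm_classForm_le_dilatedFourier` on the window of `…LayersFormReductionZero` (`q ≥ 64`, `Δ' ≤ 101/100`,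
`0 ≤ η ≤ 1/100`, `q̂^{11/10} < r`):
* `ceil_rpow_le_sq`: `Y = ⌈q̂^{2+η}⌉ ≤ q²`;
* `hyperbola_le_boxes`: `Y/(d₁t₁·d₂t₂) ≤ (q²/d₁/t₁)·(q²/d₂/t₂)` for `t₂ ≤ q²/d₂` (the `hV` input);
* **`dilatedAFE_le_classModulus`**: `(s₂t₂/g)·(Y/(d₁t₁·d₂t₂)) ≤ qr/g` whenever `g ∣ s₂t₂` and `s₂ ≤ M = ⌊q̂^{Δ'}⌋`
  (`s₂Y ≤ 2q̂^{3.02} ≤ 4π²q̂^{3.1} ≤ qr`): Pascadi's `N ≤ c` for the AFE side holds on EVERY class, so only the mollifier side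
  `σ₁'Z₁Z₂ ≤ qr/g` distinguishes the Pascadi classes from the dilated-Parseval classes (census CENSUS-leafhand2-g2).
Proof only (def-free helper); K_A NOT proved; nothing about Landau–Siegel zeros.
-/

noncomputable section

open scoped Real Nat
open Complex Finset Polynomial MeasureTheory
open Literature.NumberTheory.LFunctions

namespace Summit.Parity.GeneralizedHardyLittlewood.Theorems.MomentsBeyondDiagonal.Layers

open Summit.Parity.GeneralizedHardyLittlewood.Theorems.PrimeLevelFamEdgeIdeaDeltas.PeterssonLayers

/-- `⌈q̂^{2+η}⌉ ≤ q²` for `q ≥ 64`, `0 ≤ η ≤ 1/100` (`⌈q̂^{2+η}⌉ ≤ 2q̂^{2.01} ≤ 2q̂⁴ ≤ 16π⁴q̂⁴ = q²`). [folklore] -/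
theorem ceil_rpow_le_sq {q : ℕ} [NeZero q] (h64 : 64 ≤ q) {η : ℝ} (hη0 : 0 ≤ η) (hη : η ≤ 1 / 100) :
    ⌈KMV2000.qhat q ^ (2 + η)⌉₊ ≤ q ^ 2 := by
  have hqh1 : 1 < KMV2000.qhat q := one_lt_qhat h64
  have hqh0 : 0 < KMV2000.qhat q := zero_lt_one.trans hqh1
  set x : ℝ := KMV2000.qhat q with hx
  have hY : ((⌈x ^ (2 + η)⌉₊ : ℕ) : ℝ) ≤ 2 * x ^ (201 / 100 : ℝ) :=
    (natCeil_le_two_mul (Real.one_le_rpow hqh1.le (by linarith))).trans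
      (mul_le_mul_of_nonneg_left (Real.rpow_le_rpow_of_exponent_le hqh1.le (by linarith)) (by norm_num))
  have h4 : x ^ (201 / 100 : ℝ) ≤ x ^ (4 : ℝ) := Real.rpow_le_rpow_of_exponent_le hqh1.le (by norm_num)
  have hq : ((q : ℕ) : ℝ) = 4 * π ^ 2 * x ^ 2 := by rw [hx]; exact natCast_eq_four_pi_sq_mul_qhat_sq q
  have hq2 : ((q ^ 2 : ℕ) : ℝ) = 16 * π ^ 4 * x ^ (4 : ℝ) := by
    rw [show (4 : ℝ) = ((4 : ℕ) : ℝ) by norm_num, Real.rpow_natCast]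
    push_cast
    rw [hq]
    ring
  have hπ : (2 : ℝ) ≤ 16 * π ^ 4 := by
    have h3 : (3 : ℝ) < π := Real.pi_gt_three
    have h9 : (9 : ℝ) ≤ π ^ 2 := by nlinarith
    nlinarith [sq_nonneg (π ^ 2)]
  have hreal : ((⌈x ^ (2 + η)⌉₊ : ℕ) : ℝ) ≤ ((q ^ 2 : ℕ) : ℝ) := by
    rw [hq2]
    calc ((⌈x ^ (2 + η)⌉₊ : ℕ) : ℝ) ≤ 2 * x ^ (201 / 100 : ℝ) := hY
      _ ≤ 2 * x ^ (4 : ℝ) := by gcongr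
      _ ≤ 16 * π ^ 4 * x ^ (4 : ℝ) := mul_le_mul_of_nonneg_right hπ (Real.rpow_nonneg hqh0.le _)
  exact_mod_cast hreal

/-- **The hyperbola fits in the AFE boxes**: for `dᵢ, tᵢ ≥ 1`, `t₂ ≤ q²/d₂` and `Y ≤ q²`,
`Y/(d₁t₁·d₂t₂) ≤ (q²/d₁/t₁)·(q²/d₂/t₂)`. [folklore] -/
theorem hyperbola_le_boxes {q Y d₁ d₂ t₁ t₂ : ℕ} (hd₁ : 1 ≤ d₁) (hd₂ : 1 ≤ d₂) (ht₁ : 1 ≤ t₁)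
    (ht₂ : t₂ ∈ Icc 1 (q ^ 2 / d₂)) (hY : Y ≤ q ^ 2) :
    Y / (d₁ * t₁ * (d₂ * t₂)) ≤ (q ^ 2 / d₁ / t₁) * (q ^ 2 / d₂ / t₂) := by
  obtain ⟨ht₂1, ht₂le⟩ := mem_Icc.mp ht₂
  have hW₂ : 1 ≤ q ^ 2 / d₂ / t₂ := by
    rw [Nat.le_div_iff_mul_le (by omega), one_mul]
    exact ht₂le
  have h1 : Y / (d₁ * t₁ * (d₂ * t₂)) ≤ Y / (d₁ * t₁) :=
    Nat.div_le_div_left (Nat.le_mul_of_pos_right _ (by positivity)) (by positivity)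
  have h2 : Y / (d₁ * t₁) ≤ q ^ 2 / d₁ / t₁ := by
    rw [Nat.div_div_eq_div_mul]
    exact Nat.div_le_div_right hY
  calc Y / (d₁ * t₁ * (d₂ * t₂)) ≤ q ^ 2 / d₁ / t₁ := h1.trans h2
    _ = q ^ 2 / d₁ / t₁ * 1 := (mul_one _).symm
    _ ≤ q ^ 2 / d₁ / t₁ * (q ^ 2 / d₂ / t₂) := Nat.mul_le_mul_left _ hW₂

/-- `s·Y ≤ q·r` on the band: for `q ≥ 64`, `s ≤ ⌊q̂^{Δ'}⌋`, `Δ' ≤ 101/100`, `0 ≤ η ≤ 1/100`, `Y = ⌈q̂^{2+η}⌉` and `q̂^{11/10} < r`.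
[folklore] -/
theorem sharp_mul_Y_le_modulus {q : ℕ} [NeZero q] (h64 : 64 ≤ q) {Δ' η : ℝ} (hΔ' : Δ' ≤ 101 / 100) (hη0 : 0 ≤ η)
    (hη : η ≤ 1 / 100) {r s : ℕ} (hr : KMV2000.qhat q ^ (11 / 10 : ℝ) < r) (hs : s ≤ ⌊KMV2000.qhat q ^ Δ'⌋₊) :
    s * ⌈KMV2000.qhat q ^ (2 + η)⌉₊ ≤ q * r := by
  have hqh1 : 1 < KMV2000.qhat q := one_lt_qhat h64
  have hqh0 : 0 < KMV2000.qhat q := zero_lt_one.trans hqh1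
  set x : ℝ := KMV2000.qhat q with hx
  have hsx : (s : ℝ) ≤ x ^ (101 / 100 : ℝ) :=
    ((Nat.cast_le.mpr hs).trans (Nat.floor_le (Real.rpow_nonneg hqh0.le _))).trans
      (Real.rpow_le_rpow_of_exponent_le hqh1.le hΔ')
  have hY : ((⌈x ^ (2 + η)⌉₊ : ℕ) : ℝ) ≤ 2 * x ^ (201 / 100 : ℝ) :=
    (natCeil_le_two_mul (Real.one_le_rpow hqh1.le (by linarith))).trans
      (mul_le_mul_of_nonneg_left (Real.rpow_le_rpow_of_exponent_le hqh1.le (by linarith)) (by norm_num))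
  have hq : ((q : ℕ) : ℝ) = 4 * π ^ 2 * x ^ 2 := by rw [hx]; exact natCast_eq_four_pi_sq_mul_qhat_sq q
  have hπ : (2 : ℝ) ≤ 4 * π ^ 2 := by nlinarith [Real.pi_gt_three]
  have hreal : ((s * ⌈x ^ (2 + η)⌉₊ : ℕ) : ℝ) ≤ ((q * r : ℕ) : ℝ) := by
    push_cast
    rw [hq]
    calc (s : ℝ) * ((⌈x ^ (2 + η)⌉₊ : ℕ) : ℝ) ≤ x ^ (101 / 100 : ℝ) * (2 * x ^ (201 / 100 : ℝ)) :=
          mul_le_mul hsx hY (Nat.cast_nonneg _) (Real.rpow_nonneg hqh0.le _)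
      _ = 2 * x ^ (302 / 100 : ℝ) := by
          rw [show (302 / 100 : ℝ) = 101 / 100 + 201 / 100 by norm_num, Real.rpow_add hqh0]; ring
      _ ≤ 2 * (x ^ (2 : ℝ) * x ^ (11 / 10 : ℝ)) := by
          rw [← Real.rpow_add hqh0]
          exact mul_le_mul_of_nonneg_left (Real.rpow_le_rpow_of_exponent_le hqh1.le (by norm_num)) (by norm_num)
      _ ≤ 4 * π ^ 2 * (x ^ (2 : ℝ) * (r : ℝ)) :=
          mul_le_mul hπ (mul_le_mul_of_nonneg_left hr.le (Real.rpow_nonneg hqh0.le _)) (by positivity) (by positivity)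
      _ = 4 * π ^ 2 * x ^ 2 * r := by rw [Real.rpow_two]; ring
  exact_mod_cast hreal

/-- **The dilated AFE length never exceeds the class modulus**: with `g ∣ s₂t₂`, all of `dᵢ, tᵢ ≥ 1`, `s₂ ≤ ⌊q̂^{Δ'}⌋` and
the band/window hypotheses of `sharp_mul_Y_le_modulus`:  `(s₂t₂/g) · (Y/(d₁t₁·d₂t₂)) ≤ qr/g`, `Y = ⌈q̂^{2+η}⌉`. [folklore] -/
theorem dilatedAFE_le_classModulus {q : ℕ} [NeZero q] (h64 : 64 ≤ q) {Δ' η : ℝ} (hΔ' : Δ' ≤ 101 / 100) (hη0 : 0 ≤ η)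
    (hη : η ≤ 1 / 100) {r s₂ t₂ d₁ d₂ t₁ g : ℕ} (hr : KMV2000.qhat q ^ (11 / 10 : ℝ) < r)
    (hs₂ : s₂ ≤ ⌊KMV2000.qhat q ^ Δ'⌋₊) (hd₁ : 1 ≤ d₁) (hd₂ : 1 ≤ d₂) (ht₁ : 1 ≤ t₁) (ht₂ : 1 ≤ t₂)
    (hg : g ∣ s₂ * t₂) (hg0 : 0 < g) :
    s₂ * t₂ / g * (⌈KMV2000.qhat q ^ (2 + η)⌉₊ / (d₁ * t₁ * (d₂ * t₂))) ≤ q * r / g := by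
  set Y : ℕ := ⌈KMV2000.qhat q ^ (2 + η)⌉₊ with hYdef
  rw [Nat.le_div_iff_mul_le hg0]
  have h1 : s₂ * t₂ / g * (Y / (d₁ * t₁ * (d₂ * t₂))) * g = s₂ * t₂ * (Y / (d₁ * t₁ * (d₂ * t₂))) := by
    rw [mul_comm, ← mul_assoc, Nat.mul_div_cancel' hg]
  rw [h1]
  -- `t₂ · (Y/(… t₂)) ≤ Y`
  have h2 : Y / (d₁ * t₁ * (d₂ * t₂)) ≤ Y / t₂ :=
    Nat.div_le_div_left (by
      calc t₂ = 1 * t₂ := (one_mul _).symm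
        _ ≤ d₁ * t₁ * d₂ * t₂ := Nat.mul_le_mul_right _ (by
            have : 1 ≤ d₁ * t₁ * d₂ := by
              calc 1 = 1 * 1 * 1 := by ring
                _ ≤ d₁ * t₁ * d₂ := Nat.mul_le_mul (Nat.mul_le_mul hd₁ ht₁) hd₂
            exact this)
        _ = d₁ * t₁ * (d₂ * t₂) := by ring) (by omega)
  have h3 : t₂ * (Y / t₂) ≤ Y := Nat.mul_div_le Y t₂
  calc s₂ * t₂ * (Y / (d₁ * t₁ * (d₂ * t₂))) ≤ s₂ * t₂ * (Y / t₂) := Nat.mul_le_mul_left _ h2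
    _ = s₂ * (t₂ * (Y / t₂)) := by ring
    _ ≤ s₂ * Y := Nat.mul_le_mul_left _ h3
    _ ≤ q * r := sharp_mul_Y_le_modulus h64 hΔ' hη0 hη hr hs₂

end Summit.Parity.GeneralizedHardyLittlewood.Theorems.MomentsBeyondDiagonal.Layers

end
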